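import Literature.MathematicalPhysics.QuantumFieldTheory.Balaban1983to89.B9Eq326OperatorAssembly
import Literature.MathematicalPhysics.QuantumFieldTheory.Balaban1983to89.B5Eq172HodgePositivity
import Literature.MathematicalPhysics.QuantumFieldTheory.Balaban1983to89.Beta.CoordCubePoincare

/-!
# `Balaban1983to89.B9Eq323FlatBlockPoincare` — T. Bałaban, *Propagators for lattice gauge theories in a background field*, Commun. Math. Phys.
# **99** (1985) 389–434 [Balaban1985BackgroundPropagators] (3.21)–(3.23) p. 394 with p. 395, and *Regularity and decay of lattice Green's
# functions*, Commun. Math. Phys. **89** (1983) 571–597 [Balaban1983RegularityDecay] (2.27) p. 580: THE FLAT COVARIANT LAPLACE OPERATOR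
# `Δ^η_1 = D*_1 D_1` OF THE pub-balaban NE9 CHAIN IS COERCIVE ON `N(Q′(1)) = {λ : Q′(1)λ = 0}` WITH THE EXPLICIT, VOLUME-INDEPENDENT
# CONSTANT `2/(L²η²)` — the block Poincaré inequality of the cell's kernel module `Beta.CoordCubePoincare` transported to the chain's torus
# `TSite d (L·m)` and lifted to the Hilbert fibre; the flat injectivity modulus `μ₁` of the NE9 owner's `B9Eq384RemainderLetters` §2 made explicit

statement-level skeleton of published theorems with citation tags; proofs where landed; nothing here is a claim about the Yang–Mills mass gap

PDF held: `paper:balaban1985-cmp99-background-propagators` (+388) pp. 394–395; `paper:balaban1983-cmp89-regularity-decay` p. 580;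
`paper:balaban1984-cmp95-propagators-rt-i` p. 22 — read by this seat (2026-08-22) in the held text layers.

THE PRINT (verbatim).  [B9] p. 394: *«R = R(U) is an orthogonal projection in the Hilbert space L²(Ω₀, g) onto the subspace ℛ = Δ^η_U N(Q′),
N(Q′) = {λ : Q′λ = 0}. (3.21) … Δ^η_U = D^{η*}_U D^η_U (3.23)»*; p. 395: *«Assuming some regularity of the configuration U it can be easily shown
that the operator Δ′_a is positive.»*  [B4] p. 580: *«The operator −Δ^{η,N}_Δ is bounded from below by π² on a subspace of functions on Δ
orthogonal to constant functions, which are its eigenvectors corresponding to eigenvalue 0. … thus ⟨φ, (−Δ^{η,N}_Δ + a_kP_k)φ⟩ ≥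
min{π², a_k}‖φ‖²_{L²(Δ)} (2.27)»*.  [B5] p. 22: *«on the subspace orthogonal to constant functions the operator Δ is positive.»*

WHY THIS FILE (cell context).  The NE9 owner's (gen 80) `B9Eq384RemainderLetters.exists_flat_modulus` obtains the flat injectivity modulus
`μ₁` (`μ₁‖λ‖ ≤ ‖Δ^η_1 λ‖` on `N(Q′(1))`) by COMPACTNESS (`exists_modulus_of_ker_inj` over `covLaplace_flat_ker_inj`): an unnamed number depending
on the volume `m`, the weight `c₀` and the fibre, listed by the owner's junction `B9Thm311SmallFieldClosed` among the non-uniform constants of its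
small-field thresholds ((M3) there).  Here `μ₁ := 2/(L²η²)` for EVERY volume, weight and fibre — the block side `Lη` is the only scale, as in
print's (2.27) (lattice device: `2/((L−1)L)` per unit block for print's continuum `1/π²`, cf. `B4Lower18RegularRegion`).

WHAT IS PROVED (sorry-free; no `Prop` placeholder; no inequality of the papers asserted as a hypothesis-free fact about their objects).
* §1 **`real_blockPoincare`**: `Σ_{x∈B(y)} (f x − avg)² ≤ ((L−1)L/2)·Σ_{bonds inside B(y)} (f(b₊) − f(b₋))²` for real `f` on the torus
  `TSite d (fineP L m)` and its blocks `B9Eq319QprimeTorus.blockOf` — `Beta.CoordCubePoincare.blockPoincare_of_charts` (constant `n(n+1)/2`,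
  `n + 1 = L`, `d`-independent) AT the block charts `(y, r) ↦ (L·y_i + r_i)_i` built in the proof (in a block the torus step
  `B9SectCLatticeCarrier.shift` is `stepUp` of the offset); `sum_internal_le` (the intra-block bond sums add up to at most the full bond sum).
* §2 the Hilbert-fibre lift: `norm_sq_eq_sum_re_im` (Parseval, re/im form), **`hilbert_blockPoincare`** (`W`-valued `g` with vanishing block mean:
  `Σ_{x∈B(y)} ‖g x‖² ≤ ((L−1)L/2)·Σ_{bonds inside B(y)} ‖g(b₊) − g(b₋)‖²`), **`hilbert_torusPoincare`** (all block means vanish ⇒ `Σ_x ‖g x‖² ≤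
  ((L−1)L/2)·Σ_b ‖g(b₊) − g(b₋)‖²` over the whole torus).
* §3 the chain's letters: `sum_blockOf_eq_zero_of_QprimeW_one` (`Q′(1)λ = 0` ⇒ every block sum vanishes), **`norm_sq_le_flat_covDeriv`** (`‖λ‖² ≤
  ((L−1)L/2)·η²·‖D^η_1 λ‖²`), **`norm_sq_le_re_inner_covLaplace_flat`** (`‖λ‖² ≤ ((L−1)L/2)·η²·re⟨λ, Δ^η_1 λ⟩`), `norm_le_flat_covLaplace`,
  **`flat_modulus_explicit`** (`(2/(L²η²))·‖λ‖ ≤ ‖Δ^η_1 λ‖`) and **`exists_flat_modulus_explicit`** — LITERALLY the statement shape of the owner's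
  `exists_flat_modulus` (`∃ μ > 0, ∀ λ, Q′(1)λ = 0 → μ‖λ‖ ≤ ‖Δ^η_1 λ‖`) with the witness `2/(L²η²)`.
MODEL / DECLARED READINGS.  (M1) the chain's encodings: `B11Eq103H1Complex.SiteL2K/covDerivL2K/covLaplaceSiteK` (uniform weight `c₀`, scalar
`η⁻¹`), `B9Eq326OperatorAssembly.QprimeW` at `U = 1` (= the plain block mean, `Qprime_flat`), transporters `adTransportW φ 1 = id`
(`B5Eq172HodgePositivity.adTransportW_one`).  (M2) no displayed hypothesis of the papers; `η ≠ 0`.  (M3) NOT HERE: the flat constant `γ₀` of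
`B5Eq172FlatCoercivity.exists_coercive_principal_flat` (the BOND-field operator `D*D + DR(1)D* + aQ*Q` needs the 1-form Hodge–Poincaré package,
not this 0-form inequality); print's multi-level operators (3.16)/(3.24); backgrounds `U ≠ 1`.
HONEST SCOPE.  A [folklore] discrete inequality (the cell's own kernel `Beta/BlockPoincare`, `Beta/CoordCubePoincare`) instantiated on the
chain's OWN carriers; an explicit constant replaces an existential one; NOT summit progress (cell pub-balaban: NE9 NOT PRINTED / NOT PROVED; spine
PROVED 0/9; rung (B)+1 finite T⁴ — NOT infinite volume, NOT mass gap, NOT Clay).  Filed by the NE9 formalisation leaf `b2b-balaban-t4-ne9-formalise-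
leaf-04` (gen 69); NEW file importing `B9Eq326OperatorAssembly`, `B5Eq172HodgePositivity`, `Beta.CoordCubePoincare`.  Net new unproved facts: 0.
-/

noncomputable section

open scoped InnerProductSpace ComplexConjugate BigOperators

namespace Literature.MathematicalPhysics.QuantumFieldTheory.Balaban1983to89.B9Eq323FlatBlockPoincare

open B4Sect5Torus (TSite)
open B9SectCLatticeCarrier (Bond shift)
open B9Eq311L2Pairing (WL2)
open B9Eq319QprimeTorus (fineP blockCoord blockOf Qprime_flat QprimeLin_apply)
open B11Eq103H1Complex (SiteL2K BondL2K covDerivL2K covDivL2K covLaplaceSiteK equiv_covDerivL2K inner_covDivL2K_covDerivL2K)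
open B9Eq310HessianOperator (adTransportW)
open B9Eq326OperatorAssembly (QprimeW)
open B5Eq172HodgePositivity (adTransportW_one adTransportW_inv_one hRS_one)
open Beta.CoordCubePoincare (stepUp blockPoincare_of_charts)
open Beta.BlockPoincare (avg)

variable {d : ℕ} (L : ℕ) [NeZero L] (m : Fin d → ℕ)

/-! ## §1 The real block Poincaré inequality on the torus ([B4] (2.27), lattice constant `(L−1)L/2`), by block charts -/

section Real

/-- The intra-block bond sums, summed over the blocks, are at most the full bond sum (non-negative summands). [cite: Balaban1983RegularityDecay, (2.26) p.580] -/
theorem sum_internal_le {ι κ β : Type*} [Fintype κ] [Fintype β] [DecidableEq β] (blk : ι → β) (src tgt : κ → ι) (F : κ → ℝ)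
    (hF : ∀ k, 0 ≤ F k) :
    ∑ b, ∑ k ∈ Finset.univ.filter (fun k => blk (src k) = b ∧ blk (tgt k) = b), F k ≤ ∑ k, F k := by
  have hsub : ∑ b, ∑ k ∈ Finset.univ.filter (fun k => blk (src k) = b ∧ blk (tgt k) = b), F k
      = ∑ k ∈ Finset.univ.filter (fun k => blk (src k) = blk (tgt k)), F k := by
    rw [← Finset.sum_fiberwise_of_maps_to (s := Finset.univ.filter fun k => blk (src k) = blk (tgt k)) (t := Finset.univ)
      (g := fun k => blk (src k)) (fun k _ => Finset.mem_univ _) F]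
    refine Finset.sum_congr rfl fun b _ => Finset.sum_congr ?_ fun k _ => rfl
    ext k
    simp only [Finset.mem_filter, Finset.mem_univ, true_and]
    exact ⟨fun ⟨h1, h2⟩ => ⟨h1.trans h2.symm, h1⟩, fun ⟨h1, h2⟩ => ⟨h2, h1.symm.trans h2⟩⟩
  rw [hsub]
  exact Finset.sum_le_sum_of_subset_of_nonneg (Finset.filter_subset _ _) fun k _ _ => hF k

variable {n : ℕ} (hn : n + 1 = L)

include hn in
/-- **THE BLOCK POINCARÉ INEQUALITY ON THE TORUS, real functions** ([B4] (2.27)'s first sentence in lattice form): on every block `B(y)` of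
`TSite d (fineP L m)` (`B9Eq319QprimeTorus.blockOf/blockCoord`, [Balaban1985Averaging] (2) p. 17), `Σ_{x∈B(y)} (f x − avg_{B(y)} f)² ≤
((L−1)L/2)·Σ_{b : b₋, b₊ ∈ B(y)} (f(b₊) − f(b₋))²` — the cell's `Beta.CoordCubePoincare.blockPoincare_of_charts` (constant `n(n+1)/2`, `n + 1 = L`)
AT THE BLOCK CHARTS `(y, r) ↦ (L·y_i + r_i)_i` (lands in `B(y)`, injective, jointly onto; the torus step `B9SectCLatticeCarrier.shift` inside a
block is `stepUp` of the offset — no wrap-around off the last layer). [cite: Balaban1983RegularityDecay, (2.27) p.580] -/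
theorem real_blockPoincare (y : TSite d m) (f : TSite d (fineP L m) → ℝ) :
    ∑ x ∈ Finset.univ.filter (fun x => blockCoord L m x = y), (f x - avg (Finset.univ.filter fun x => blockCoord L m x = y) f) ^ 2
      ≤ (n : ℝ) * (n + 1) / 2 *
        ∑ b ∈ Finset.univ.filter (fun b : Bond d (fineP L m) => blockCoord L m b.1 = y ∧ blockCoord L m (shift b.2 b.1) = y),
          (f (shift b.2 b.1) - f b.1) ^ 2 := by
  have hL : 0 < L := Nat.pos_of_ne_zero (NeZero.ne L)
  have hrL : ∀ r : Fin (n + 1), (r : ℕ) < L := fun r => by have := r.isLt; omega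
  have hroom : ∀ (y : TSite d m) (i : Fin d) (t : ℕ), t < L → L * (y i : ℕ) + t < fineP L m i := fun y i t ht =>
    calc L * (y i : ℕ) + t < L * (y i : ℕ) + L := by omega
      _ = L * ((y i : ℕ) + 1) := by ring
      _ ≤ L * m i := Nat.mul_le_mul_left L (y i).isLt
  -- the block chart `(y, r) ↦ (L·y_i + r_i)_i`
  let ch : TSite d m → (Fin d → Fin (n + 1)) → TSite d (fineP L m) := fun y r i => ⟨L * (y i : ℕ) + r i, hroom y i _ (hrL (r i))⟩
  have hch : ∀ y r i, ((ch y r i : ℕ)) = L * (y i : ℕ) + r i := fun _ _ _ => rfl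
  have hblk : ∀ y r, blockCoord L m (ch y r) = y := fun y r => by
    funext i
    apply Fin.ext
    rw [B9Eq319QprimeTorus.blockCoord_apply_val, hch, Nat.mul_add_div hL, Nat.div_eq_of_lt (hrL (r i)), add_zero]
  have hinj : ∀ y, Function.Injective (ch y) := fun y r r' h => by
    funext i
    apply Fin.ext
    have hi := congr_arg (fun x : TSite d (fineP L m) => ((x i : ℕ))) h
    simp only [hch] at hi
    omega
  have hsurj : ∀ x : TSite d (fineP L m), ∃ r, ch (blockCoord L m x) r = x := fun x =>
    ⟨fun i => ⟨(x i : ℕ) % L, by have := Nat.mod_lt (x i : ℕ) hL; omega⟩, by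
      funext i
      apply Fin.ext
      exact Nat.div_add_mod (x i : ℕ) L⟩
  have hstep : ∀ (y : TSite d m) (μ : Fin d) (r : Fin d → Fin (n + 1)), r μ ≠ Fin.last n → shift μ (ch y r) = ch y (stepUp r μ) := by
    intro y μ r hr
    funext i
    by_cases hi : i = μ
    · subst hi
      apply Fin.ext
      have hlt : r i < Fin.last n := Fin.lt_last_iff_ne_last.mpr hr
      have h1 : ((r i + 1 : Fin (n + 1)) : ℕ) = (r i : ℕ) + 1 := Fin.val_add_one_of_lt hlt
      have h3 : (r i : ℕ) < n := by rw [Fin.lt_def, Fin.val_last] at hlt; exact hlt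
      rw [B9SectCLatticeCarrier.shift_apply_val, hch, hch]
      simp only [stepUp, Function.update_self, h1]
      have h4 := hroom y i ((r i : ℕ) + 1) (by omega)
      rw [Nat.mod_eq_of_lt (by omega)]
      omega
    · rw [B9SectCLatticeCarrier.shift_apply_ne hi]
      apply Fin.ext
      simp only [hch, stepUp, Function.update_of_ne hi]
  exact blockPoincare_of_charts (blockCoord L m) (fun b : Bond d (fineP L m) => b.1) (fun b : Bond d (fineP L m) => shift b.2 b.1) n d
    ch hblk hinj hsurj (fun y μ r => (ch y r, μ)) (fun _ _ _ _ => rfl) hstep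
    (fun y p _ p' _ hpp => by simp only [Prod.mk.injEq] at hpp; exact Prod.ext hpp.2 (hinj y hpp.1)) y f

end Real

/-! ## §2 The lift to the Hilbert fibre (Parseval) -/

section Hilbert

variable {W : Type*} [NormedAddCommGroup W] [InnerProductSpace ℂ W] [FiniteDimensional ℂ W]

omit [FiniteDimensional ℂ W] in
/-- Parseval in re/im form: `‖w‖² = Σ_j ((re⟨b_j, w⟩)² + (im⟨b_j, w⟩)²)` for an orthonormal basis `b`. [folklore]
[cite: Balaban1985BackgroundPropagators, (3.11) p.392] -/
theorem norm_sq_eq_sum_re_im {ι : Type*} [Fintype ι] (b : OrthonormalBasis ι ℂ W) (w : W) :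
    ‖w‖ ^ 2 = ∑ j, ((⟪b j, w⟫_ℂ).re ^ 2 + (⟪b j, w⟫_ℂ).im ^ 2) := by
  rw [← b.sum_sq_norm_inner_right w]
  refine Finset.sum_congr rfl fun j _ => ?_
  rw [Complex.sq_norm, Complex.normSq_apply]
  ring

variable {n : ℕ} (hn : n + 1 = L)

include hn in
/-- **THE BLOCK POINCARÉ INEQUALITY for `W`-valued site functions with vanishing block mean**: `Σ_{x∈B(y)} ‖g x‖² ≤ ((L−1)L/2)·
Σ_{b : b₋, b₊ ∈ B(y)} ‖g(b₊) − g(b₋)‖²` — §1 applied to the real coordinate functionals `re⟨b_j, g⟩`, `im⟨b_j, g⟩` (each of vanishing block mean)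
and re-summed by Parseval. [cite: Balaban1983RegularityDecay, (2.27) p.580] -/
theorem hilbert_blockPoincare (y : TSite d m) (g : TSite d (fineP L m) → W)
    (hg : ∑ x ∈ Finset.univ.filter (fun x => blockCoord L m x = y), g x = 0) :
    ∑ x ∈ Finset.univ.filter (fun x => blockCoord L m x = y), ‖g x‖ ^ 2
      ≤ (n : ℝ) * (n + 1) / 2 *
        ∑ b ∈ Finset.univ.filter (fun b : Bond d (fineP L m) => blockCoord L m b.1 = y ∧ blockCoord L m (shift b.2 b.1) = y),
          ‖g (shift b.2 b.1) - g b.1‖ ^ 2 := by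
  set B := stdOrthonormalBasis ℂ W
  set Bl := Finset.univ.filter (fun x : TSite d (fineP L m) => blockCoord L m x = y) with hBl
  set S := Finset.univ.filter (fun b : Bond d (fineP L m) => blockCoord L m b.1 = y ∧ blockCoord L m (shift b.2 b.1) = y) with hS
  set P : ℝ := (n : ℝ) * (n + 1) / 2
  have hcoord : ∀ (ℓ : ℂ → ℝ), (∀ z z' : ℂ, ℓ (z - z') = ℓ z - ℓ z') → (∀ (s : Finset (TSite d (fineP L m))) (h : TSite d (fineP L m) → ℂ),
      ℓ (∑ x ∈ s, h x) = ∑ x ∈ s, ℓ (h x)) → ℓ 0 = 0 → ∀ j,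
      ∑ x ∈ Bl, (ℓ ⟪B j, g x⟫_ℂ) ^ 2 ≤ P * ∑ b ∈ S, (ℓ ⟪B j, g (shift b.2 b.1) - g b.1⟫_ℂ) ^ 2 := by
    intro ℓ hsub hsum h0 j
    have h := real_blockPoincare L m hn y (fun x => ℓ ⟪B j, g x⟫_ℂ)
    have havg : avg Bl (fun x => ℓ ⟪B j, g x⟫_ℂ) = 0 := by
      unfold avg
      rw [← hsum, ← inner_sum, hg, inner_zero_right, h0, zero_div]
    rw [← hBl, havg] at h
    simp only [sub_zero] at h
    refine h.trans (le_of_eq ?_)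
    rw [← hS]
    congr 1
    refine Finset.sum_congr rfl fun b _ => ?_
    rw [inner_sub_right, hsub]
  have hre := hcoord Complex.re (fun z z' => Complex.sub_re z z') (fun s h => Complex.re_sum s h) Complex.zero_re
  have him := hcoord Complex.im (fun z z' => Complex.sub_im z z') (fun s h => Complex.im_sum s h) Complex.zero_im
  calc ∑ x ∈ Bl, ‖g x‖ ^ 2 = ∑ x ∈ Bl, ∑ j, ((⟪B j, g x⟫_ℂ).re ^ 2 + (⟪B j, g x⟫_ℂ).im ^ 2) :=
        Finset.sum_congr rfl fun x _ => norm_sq_eq_sum_re_im B (g x)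
    _ = ∑ j, (∑ x ∈ Bl, (⟪B j, g x⟫_ℂ).re ^ 2 + ∑ x ∈ Bl, (⟪B j, g x⟫_ℂ).im ^ 2) := by
        rw [Finset.sum_comm]
        exact Finset.sum_congr rfl fun j _ => Finset.sum_add_distrib
    _ ≤ ∑ j, (P * ∑ b ∈ S, ((⟪B j, g (shift b.2 b.1) - g b.1⟫_ℂ).re) ^ 2
          + P * ∑ b ∈ S, ((⟪B j, g (shift b.2 b.1) - g b.1⟫_ℂ).im) ^ 2) :=
        Finset.sum_le_sum fun j _ => add_le_add (hre j) (him j)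
    _ = P * ∑ b ∈ S, ∑ j, (((⟪B j, g (shift b.2 b.1) - g b.1⟫_ℂ).re) ^ 2 + ((⟪B j, g (shift b.2 b.1) - g b.1⟫_ℂ).im) ^ 2) := by
        rw [Finset.sum_comm, Finset.mul_sum]
        refine Finset.sum_congr rfl fun b _ => ?_
        rw [Finset.sum_add_distrib, mul_add, Finset.mul_sum, Finset.mul_sum]
    _ = P * ∑ b ∈ S, ‖g (shift b.2 b.1) - g b.1‖ ^ 2 := by
        congr 1
        exact Finset.sum_congr rfl fun b _ => (norm_sq_eq_sum_re_im B _).symm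

include hn in
/-- **THE TORUS-WIDE POINCARÉ INEQUALITY for `W`-valued site functions all of whose block means vanish**: `Σ_x ‖g x‖² ≤ ((L−1)L/2)·
Σ_b ‖g(b₊) − g(b₋)‖²` (blocks summed by `blockCoord`; the intra-block bonds are among all bonds). UNIFORM in the volume `m`.
[cite: Balaban1983RegularityDecay, (2.26)–(2.27) p.580] -/
theorem hilbert_torusPoincare (g : TSite d (fineP L m) → W)
    (hg : ∀ y, ∑ x ∈ Finset.univ.filter (fun x => blockCoord L m x = y), g x = 0) :
    ∑ x, ‖g x‖ ^ 2 ≤ (n : ℝ) * (n + 1) / 2 * ∑ b : Bond d (fineP L m), ‖g (shift b.2 b.1) - g b.1‖ ^ 2 := by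
  have hP : 0 ≤ (n : ℝ) * (n + 1) / 2 := by positivity
  rw [← Finset.sum_fiberwise_of_maps_to (s := Finset.univ) (t := Finset.univ) (g := blockCoord L m) (fun x _ => Finset.mem_univ _)
    (fun x => ‖g x‖ ^ 2)]
  calc ∑ y, ∑ x ∈ Finset.univ.filter (fun x => blockCoord L m x = y), ‖g x‖ ^ 2
      ≤ ∑ y, (n : ℝ) * (n + 1) / 2 *
          ∑ b ∈ Finset.univ.filter (fun b : Bond d (fineP L m) => blockCoord L m b.1 = y ∧ blockCoord L m (shift b.2 b.1) = y),
            ‖g (shift b.2 b.1) - g b.1‖ ^ 2 := Finset.sum_le_sum fun y _ => hilbert_blockPoincare L m hn y g (hg y)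
    _ = (n : ℝ) * (n + 1) / 2 * ∑ y,
          ∑ b ∈ Finset.univ.filter (fun b : Bond d (fineP L m) => blockCoord L m b.1 = y ∧ blockCoord L m (shift b.2 b.1) = y),
            ‖g (shift b.2 b.1) - g b.1‖ ^ 2 := by rw [Finset.mul_sum]
    _ ≤ (n : ℝ) * (n + 1) / 2 * ∑ b : Bond d (fineP L m), ‖g (shift b.2 b.1) - g b.1‖ ^ 2 :=
        mul_le_mul_of_nonneg_left (sum_internal_le (blockCoord L m) (fun b : Bond d (fineP L m) => b.1)
          (fun b : Bond d (fineP L m) => shift b.2 b.1) (fun b => ‖g (shift b.2 b.1) - g b.1‖ ^ 2) fun _ => sq_nonneg _) hP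

end Hilbert

/-! ## §3 The NE9 chain's letters: `Δ^η_1` is coercive on `N(Q′(1))` with constant `2/(L²η²)` -/

section Chain

variable {𝔸 : Type*} [Ring 𝔸] [Algebra ℂ 𝔸] {W : Type*} [NormedAddCommGroup W] [InnerProductSpace ℂ W] [FiniteDimensional ℂ W]
  (φ : W ≃ₗ[ℂ] 𝔸) {c₀ : ℝ} [Fact (0 < c₀)] {η : ℝ} (hη : η ≠ 0)

omit [FiniteDimensional ℂ W] [Fact (0 < c₀)] in
/-- **`Q′(1)λ = 0` ⇒ EVERY BLOCK SUM OF `λ` VANISHES** (`Q′(1)` is the plain block mean `L^{−d}Σ_{x∈B(y)}`, `Qprime_flat`, at the identity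
transporters `adTransportW_one`). [cite: Balaban1985BackgroundPropagators, (3.19) p.393, (3.21) p.394] -/
theorem sum_blockOf_eq_zero_of_QprimeW_one (l : SiteL2K ℂ d (fineP L m) c₀ W)
    (hQ : QprimeW L m φ (fun _ : Bond d (fineP L m) => (1 : 𝔸ˣ)) (c₀ := c₀) l = 0) (y : TSite d m) :
    ∑ x ∈ Finset.univ.filter (fun x => blockCoord L m x = y), WL2.equiv ℂ (fun _ : TSite d (fineP L m) => c₀) W l x = 0 := by
  have hL0 : ((L : ℝ)) ^ d ≠ 0 := pow_ne_zero _ (Nat.cast_ne_zero.2 (NeZero.ne L))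
  have hflat : (fun b : Bond d (fineP L m) => (adTransportW φ (fun _ : Bond d (fineP L m) => (1 : 𝔸ˣ)) b).restrictScalars ℝ) =
      fun _ => (LinearMap.id : W →ₗ[ℝ] W) := by
    funext b
    rw [adTransportW_one]
    rfl
  have h := congr_fun hQ y
  rw [QprimeW, LinearMap.comp_apply, QprimeLin_apply, hflat, Qprime_flat] at h
  simp only [LinearEquiv.coe_coe, WL2.linearEquiv_apply, Pi.zero_apply, ← Finset.smul_sum] at h
  have h' := congr_arg (fun v : W => ((L : ℝ) ^ d) • v) h
  simp only [smul_smul, mul_inv_cancel₀ hL0, one_smul, smul_zero] at h'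
  exact h'

include hη in
/-- **(P1) `‖λ‖² ≤ ((L−1)L/2)·η²·‖D^η_1 λ‖²` ON `N(Q′(1))`** — the block Poincaré inequality for the chain's gauge parameters at the flat
background (`D^η_1 = covDerivL2K … (η⁻¹) (R 1)` = `η⁻¹`× the forward difference, `covDeriv_apply_dir`; norms `WL2.norm_sq`). UNIFORM in the volume.
[cite: Balaban1985BackgroundPropagators, (3.3) p.391, (3.21)–(3.23) p.394; Balaban1983RegularityDecay, (2.27) p.580] -/
theorem norm_sq_le_flat_covDeriv (l : SiteL2K ℂ d (fineP L m) c₀ W)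
    (hQ : QprimeW L m φ (fun _ : Bond d (fineP L m) => (1 : 𝔸ˣ)) (c₀ := c₀) l = 0) :
    ‖l‖ ^ 2 ≤ ((L : ℝ) - 1) * L / 2 * η ^ 2 *
      ‖covDerivL2K ℂ c₀ ((η : ℂ))⁻¹ (adTransportW φ (fun _ : Bond d (fineP L m) => (1 : 𝔸ˣ))) l‖ ^ 2 := by
  have hc₀ : 0 < c₀ := Fact.out
  set g := WL2.equiv ℂ (fun _ : TSite d (fineP L m) => c₀) W l with hg
  have hn : L - 1 + 1 = L := Nat.sub_add_cancel (Nat.one_le_iff_ne_zero.2 (NeZero.ne L))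
  have hcast : ((L - 1 : ℕ) : ℝ) = (L : ℝ) - 1 := by
    rw [Nat.cast_sub (Nat.one_le_iff_ne_zero.2 (NeZero.ne L)), Nat.cast_one]
  have hP := hilbert_torusPoincare L m hn g (fun y => sum_blockOf_eq_zero_of_QprimeW_one L m φ l hQ y)
  rw [hcast, sub_add_cancel] at hP
  have hl : ‖l‖ ^ 2 = c₀ * ∑ x, ‖g x‖ ^ 2 := by rw [WL2.norm_sq, Finset.mul_sum]
  have hD : ‖covDerivL2K ℂ c₀ ((η : ℂ))⁻¹ (adTransportW φ (fun _ : Bond d (fineP L m) => (1 : 𝔸ˣ))) l‖ ^ 2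
      = c₀ * (η ^ 2)⁻¹ * ∑ b : Bond d (fineP L m), ‖g (shift b.2 b.1) - g b.1‖ ^ 2 := by
    rw [WL2.norm_sq, Finset.mul_sum, Fintype.sum_prod_type, Fintype.sum_prod_type]
    refine Finset.sum_congr rfl fun x _ => Finset.sum_congr rfl fun μ _ => ?_
    rw [equiv_covDerivL2K, B9Eq33CovDerivVector.covDeriv_apply_dir, adTransportW_one, LinearMap.id_apply, norm_smul, norm_inv,
      Complex.norm_real, Real.norm_eq_abs, mul_pow, inv_pow, sq_abs]
    ring
  rw [hl, hD]
  have hη2 : η ^ 2 ≠ 0 := pow_ne_zero _ hη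
  calc c₀ * ∑ x, ‖g x‖ ^ 2 ≤ c₀ * (((L : ℝ) - 1) * L / 2 * ∑ b : Bond d (fineP L m), ‖g (shift b.2 b.1) - g b.1‖ ^ 2) :=
        mul_le_mul_of_nonneg_left hP hc₀.le
    _ = ((L : ℝ) - 1) * L / 2 * η ^ 2 * (c₀ * (η ^ 2)⁻¹ * ∑ b : Bond d (fineP L m), ‖g (shift b.2 b.1) - g b.1‖ ^ 2) := by
        field_simp

include hη in
/-- **(P2) `‖λ‖² ≤ ((L−1)L/2)·η²·re⟨λ, Δ^η_1 λ⟩` ON `N(Q′(1))`** — THE FLAT COVARIANT LAPLACE OPERATOR (3.23) IS COERCIVE ON `N(Q′(1))` with an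
explicit, volume-independent constant (`re⟨λ, D*Dλ⟩ = ‖Dλ‖²`, `inner_covDivL2K_covDerivL2K` at the flat `hRS`). Print: p. 395 «it can be easily shown
that the operator Δ′_a is positive»; [B4] (2.27). [cite: Balaban1985BackgroundPropagators, (3.21)–(3.23) p.394, p.395; Balaban1983RegularityDecay, (2.27) p.580] -/
theorem norm_sq_le_re_inner_covLaplace_flat (l : SiteL2K ℂ d (fineP L m) c₀ W)
    (hQ : QprimeW L m φ (fun _ : Bond d (fineP L m) => (1 : 𝔸ˣ)) (c₀ := c₀) l = 0) :
    ‖l‖ ^ 2 ≤ ((L : ℝ) - 1) * L / 2 * η ^ 2 *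
      (⟪l, covLaplaceSiteK ((η : ℂ))⁻¹ (adTransportW φ (fun _ : Bond d (fineP L m) => (1 : 𝔸ˣ)))
        (adTransportW φ fun _ : Bond d (fineP L m) => (1 : 𝔸ˣ)⁻¹) l⟫_ℂ).re := by
  have hc : conj ((η : ℂ))⁻¹ = ((η : ℂ))⁻¹ := by rw [map_inv₀, Complex.conj_ofReal]
  have h := inner_covDivL2K_covDerivL2K ((η : ℂ))⁻¹ hc _ _ (hRS_one (Pd := fineP L m) φ) l
  have hre : (⟪l, covLaplaceSiteK ((η : ℂ))⁻¹ (adTransportW φ (fun _ : Bond d (fineP L m) => (1 : 𝔸ˣ)))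
        (adTransportW φ fun _ : Bond d (fineP L m) => (1 : 𝔸ˣ)⁻¹) l⟫_ℂ).re
      = ‖covDerivL2K ℂ c₀ ((η : ℂ))⁻¹ (adTransportW φ (fun _ : Bond d (fineP L m) => (1 : 𝔸ˣ))) l‖ ^ 2 := by
    rw [covLaplaceSiteK, LinearMap.comp_apply, h, ← RCLike.ofReal_pow]
    exact RCLike.ofReal_re (K := ℂ) _
  rw [hre]
  exact norm_sq_le_flat_covDeriv L m φ hη l hQ

include hη in
/-- **`‖λ‖ ≤ ((L−1)L/2)·η²·‖Δ^η_1 λ‖` ON `N(Q′(1))`** (from (P2) by Cauchy–Schwarz). [cite: Balaban1985BackgroundPropagators, (3.21)–(3.23) p.394; Balaban1983RegularityDecay, (2.27) p.580] -/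
theorem norm_le_flat_covLaplace (l : SiteL2K ℂ d (fineP L m) c₀ W)
    (hQ : QprimeW L m φ (fun _ : Bond d (fineP L m) => (1 : 𝔸ˣ)) (c₀ := c₀) l = 0) :
    ‖l‖ ≤ ((L : ℝ) - 1) * L / 2 * η ^ 2 *
      ‖covLaplaceSiteK ((η : ℂ))⁻¹ (adTransportW φ (fun _ : Bond d (fineP L m) => (1 : 𝔸ˣ)))
        (adTransportW φ fun _ : Bond d (fineP L m) => (1 : 𝔸ˣ)⁻¹) l‖ := by
  set Δl := covLaplaceSiteK ((η : ℂ))⁻¹ (adTransportW φ (fun _ : Bond d (fineP L m) => (1 : 𝔸ˣ)))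
    (adTransportW φ fun _ : Bond d (fineP L m) => (1 : 𝔸ˣ)⁻¹) l
  have hP0 : 0 ≤ ((L : ℝ) - 1) * L / 2 * η ^ 2 := by
    have : 0 ≤ (L : ℝ) - 1 := by linarith [show (1 : ℝ) ≤ L by exact_mod_cast Nat.one_le_iff_ne_zero.2 (NeZero.ne L)]
    positivity
  have h := norm_sq_le_re_inner_covLaplace_flat L m φ hη l hQ
  have hcs : (⟪l, Δl⟫_ℂ).re ≤ ‖l‖ * ‖Δl‖ := (Complex.re_le_norm _).trans (norm_inner_le_norm _ _)
  by_cases hl : l = 0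
  · rw [hl, norm_zero]; positivity
  · have h3 := h.trans (mul_le_mul_of_nonneg_left hcs hP0)
    exact le_of_mul_le_mul_right (by rw [← sq]; linarith) (norm_pos_iff.2 hl)

include hη in
/-- **(P3) THE EXPLICIT FLAT INJECTIVITY MODULUS: `(2/(L²η²))·‖λ‖ ≤ ‖Δ^η_1 λ‖` ON `N(Q′(1))`** — `μ₁ = 2/(Lη)²` for every volume `m`, weight
`c₀` and fibre (`(L−1)L/2 ≤ L²/2`). [cite: Balaban1985BackgroundPropagators, (3.21)–(3.23) p.394, p.395; Balaban1983RegularityDecay, (2.27) p.580] -/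
theorem flat_modulus_explicit (l : SiteL2K ℂ d (fineP L m) c₀ W)
    (hQ : QprimeW L m φ (fun _ : Bond d (fineP L m) => (1 : 𝔸ˣ)) (c₀ := c₀) l = 0) :
    2 / ((L : ℝ) ^ 2 * η ^ 2) * ‖l‖ ≤
      ‖covLaplaceSiteK ((η : ℂ))⁻¹ (adTransportW φ (fun _ : Bond d (fineP L m) => (1 : 𝔸ˣ)))
        (adTransportW φ fun _ : Bond d (fineP L m) => (1 : 𝔸ˣ)⁻¹) l‖ := by
  set Δl := covLaplaceSiteK ((η : ℂ))⁻¹ (adTransportW φ (fun _ : Bond d (fineP L m) => (1 : 𝔸ˣ)))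
    (adTransportW φ fun _ : Bond d (fineP L m) => (1 : 𝔸ˣ)⁻¹) l
  have h := norm_le_flat_covLaplace L m φ hη l hQ
  have hL : (0 : ℝ) < L := by exact_mod_cast Nat.pos_of_ne_zero (NeZero.ne L)
  have hden : 0 < (L : ℝ) ^ 2 * η ^ 2 := by positivity
  have h1 : ((L : ℝ) - 1) * L / 2 * η ^ 2 ≤ (L : ℝ) ^ 2 * η ^ 2 / 2 := by nlinarith
  have h2 : ‖l‖ ≤ (L : ℝ) ^ 2 * η ^ 2 / 2 * ‖Δl‖ := h.trans (mul_le_mul_of_nonneg_right h1 (norm_nonneg _))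
  rw [div_mul_eq_mul_div, div_le_iff₀ hden]
  calc 2 * ‖l‖ ≤ 2 * ((L : ℝ) ^ 2 * η ^ 2 / 2 * ‖Δl‖) := by linarith
    _ = ‖Δl‖ * ((L : ℝ) ^ 2 * η ^ 2) := by ring

include hη in
/-- **THE OWNER's `B9Eq384RemainderLetters.exists_flat_modulus` SHAPE WITH AN EXPLICIT WITNESS**: `∃ μ > 0` (namely `2/(L²η²)`) with
`μ‖λ‖ ≤ ‖Δ^η_1 λ‖` for all `λ ∈ N(Q′(1))` — same statement, the compactness witness replaced by the block Poincaré constant.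
[cite: Balaban1985BackgroundPropagators, (3.21)–(3.23) p.394; Balaban1984PropagatorsI, p.22] -/
theorem exists_flat_modulus_explicit :
    ∃ μ : ℝ, 0 < μ ∧ ∀ l : SiteL2K ℂ d (fineP L m) c₀ W, QprimeW L m φ (fun _ : Bond d (fineP L m) => (1 : 𝔸ˣ)) l = 0 →
      μ * ‖l‖ ≤ ‖covLaplaceSiteK ((η : ℂ))⁻¹ (adTransportW φ (fun _ : Bond d (fineP L m) => (1 : 𝔸ˣ)))
        (adTransportW φ fun _ : Bond d (fineP L m) => (1 : 𝔸ˣ)⁻¹) l‖ := by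
  have hL : (0 : ℝ) < L := by exact_mod_cast Nat.pos_of_ne_zero (NeZero.ne L)
  exact ⟨2 / ((L : ℝ) ^ 2 * η ^ 2), by positivity, fun l hQ => flat_modulus_explicit L m φ hη l hQ⟩

end Chain

end Literature.MathematicalPhysics.QuantumFieldTheory.Balaban1983to89.B9Eq323FlatBlockPoincare
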